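import Literature.NumberTheory.Transcendental.AnalytificationMorphismsProofs
import Literature.NumberTheory.Transcendental.AnalytificationProjProofs
import Literature.NumberTheory.Transcendental.ProjectiveSpaceProofs
import HarnessLib

/-!
# GAGA: a function that is locally (holomorphic unit) · (rational) has an algebraic junk graph

J.-P. Serre, *Géométrie algébrique et géométrie analytique*, Ann. Inst. Fourier 6 (1956), n° 19
Prop. 13 (théorème de Chow) and n° 20 Remarque 1 («toute fonction méromorphe sur une variété
projective est rationnelle»); D. Mumford, *Algebraic Geometry I* (1981), §4B (4.14) (Chow's theorem
on the graph). Let `X` be smooth projective over `ℂ` with analytification `φ : M → X(ℂ)`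
(`IsAnalytification`, holomorphic atlas), `T ⊆ X` open, and `g : M → ℂ` a function which near
every point of `M` reads, on `φ⁻¹(W(ℂ))` for an open `W ⊆ X` and sections `a, b ∈ Γ(X, W)`,
`g · b(φ ·) = u · a(φ ·)` over `T`, with `u` holomorphic and nowhere zero on `φ⁻¹(W(ℂ))` and
`T ∩ W = D(a) ∩ D(b)` on complex points (a meromorphic function `g = u · (a/b)^an` whose zeros and
poles are ALGEBRAICALLY controlled). The device of this file is the **junk graph**

  `S = {(m, ζ) ∈ M × ℙ¹(ℂ) | φ m ∈ T(ℂ) → ζ = [1 : g m]}`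

— the graph of `g` over `T` completed by the WHOLE fibre `ℙ¹` over `X ∖ T` (no closure of a
meromorphic graph, no irreducible components, no indeterminacy analysis): on
`φ⁻¹(W(ℂ)) × {ζ_k ≠ 0}` it is the zero set of the single holomorphic function
`(a b)(φ m) · (ζ₁/ζ_k · b(φ m) − ζ₀/ζ_k · u(m) · a(φ m))` (`isAnalyticSet_junkGraph`). Chow's theorem
for the smooth projective `X ×_ℂ ℙ¹` (the tree's `chow_analyticSet_analytification_holds`, run on an
analytification `N` of the product exactly as in the tree's proof of GAGA for maps,
`Transcendental/AnalytificationMorphismsProofs`, `arapura2012_cor_15_4_6_holds`) then gives a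
Zariski-closed `Z ⊆ X ×_ℂ ℙ¹` with the same complex points (`exists_isClosed_junkGraph`): over
`T` the `ℂ`-points of `Z` are exactly the pairs `(x, [1 : g(φ⁻¹ x)])`.

The sequel `GAGARegularOfUnitTimesRational` restricts `Z` to the open subscheme `T`, where it is a
closed graph over a normal variety, hence the graph of a morphism `T ⟶ ℙ¹` through `D₊(x₀)`
(`Motives/ClosedGraphMorphism`), i.e. `g` is a regular function on `T`; the consumer is GAGA
injectivity on `Pic` (`GAGAPicardInjective`: `𝒪_X(D)^an ≅ 𝒪_X(E)^an` holomorphically ⇒ `D ∼ E`).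

Everything here is proved; no definitions, no named facts.

## References

* [SerreGAGA1956] J.-P. Serre, Géométrie algébrique et géométrie analytique, Ann. Inst. Fourier 6
  (1956), n° 19 Prop. 13, n° 20 Remarque 1 (pp. 29–32).
* [Mumford1981] D. Mumford, Algebraic Geometry I: Complex Projective Varieties (1981), §4B (4.14),
  p. 67.
* [GriffithsHarrisPrinciples1978] P. Griffiths, J. Harris, Principles of Algebraic Geometry (1978),
  Ch. 1 §3, pp. 167–170 (Chow's theorem; meromorphic functions on projective varieties are rational).
-/

noncomputable section

open scoped Manifold ContDiff Topology LinearAlgebra.Projectivization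
open CategoryTheory AlgebraicGeometry MonoidalCategory Set
open Literature.AlgebraicGeometry.Motives (AlgPoints ComplexPoints SchemeOver IsSmoothProjective
  projectiveSpace)
open Literature.AlgebraicGeometry.Motives.AlgPoints (evalOrZero)
open Literature.Geometry.Kaehler (IsAnalyticSet IsAnalyticSetAt)
open Literature.NumberTheory.Transcendental

namespace Literature.AlgebraicGeometry.HodgeTheory

universe u

/-! ### Points of `ℙ¹(ℂ)` of the form `[1 : t]` -/

/-- `[v₀ : v₁] = [1 : t]` in `ℙ¹(ℂ)` iff `v₀ ≠ 0` and `v₁ = v₀ t` (homogeneous coordinates on the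
chart `U₀ = {v₀ ≠ 0}`). [cite: GriffithsHarrisPrinciples1978, Ch. 0 §2 p. 15] -/
theorem projectivization_mk_eq_mk_one_iff (v : Fin 2 → ℂ) (hv : v ≠ 0) (t : ℂ) :
    Projectivization.mk ℂ v hv = Projectivization.mk ℂ ![1, t] (by simp) ↔
      v 0 ≠ 0 ∧ v 1 = v 0 * t := by
  rw [Projectivization.mk_eq_mk_iff']
  constructor
  · rintro ⟨a, ha⟩
    have h0 : v 0 = a := by
      have := congrFun ha 0
      simpa using this.symm
    have h1 : v 1 = a * t := by
      have := congrFun ha 1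
      simpa using this.symm
    refine ⟨?_, by rw [h1, h0]⟩
    intro h00
    apply hv
    have ha0 : a = 0 := by rw [← h0, h00]
    funext j
    fin_cases j
    · exact h00
    · simp [h1, ha0]
  · rintro ⟨h0, h1⟩
    refine ⟨v 0, ?_⟩
    funext j
    fin_cases j
    · simp
    · simp [h1]

/-- In the chart `{ζ₀ ≠ 0}` of `ℙ¹(ℂ)`: `ζ = [1 : t]` iff the affine coordinate `ζ₁/ζ₀` is `t`.
[cite: GriffithsHarrisPrinciples1978, Ch. 0 §2 p. 15] -/
theorem projectivization_eq_mk_one_iff_of_rep_zero_ne_zero (ζ : ℙ ℂ (Fin 2 → ℂ)) (hζ : ζ.rep 0 ≠ 0)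
    (t : ℂ) :
    ζ = Projectivization.mk ℂ ![1, t] (by simp) ↔ ζ.rep 1 / ζ.rep 0 = t := by
  conv_lhs => rw [← ζ.mk_rep]
  rw [projectivization_mk_eq_mk_one_iff, div_eq_iff hζ, mul_comm]
  exact ⟨fun h ↦ h.2, fun h ↦ ⟨hζ, h⟩⟩

/-- In the chart `{ζ₁ ≠ 0}` of `ℙ¹(ℂ)`: `ζ = [1 : t]` iff `ζ₀/ζ₁ · t = 1` (so `ζ₀ ≠ 0`).
[cite: GriffithsHarrisPrinciples1978, Ch. 0 §2 p. 15] -/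
theorem projectivization_eq_mk_one_iff_of_rep_one_ne_zero (ζ : ℙ ℂ (Fin 2 → ℂ)) (hζ : ζ.rep 1 ≠ 0)
    (t : ℂ) :
    ζ = Projectivization.mk ℂ ![1, t] (by simp) ↔ ζ.rep 0 / ζ.rep 1 * t = 1 := by
  conv_lhs => rw [← ζ.mk_rep]
  rw [projectivization_mk_eq_mk_one_iff, div_mul_eq_mul_div, div_eq_one_iff_eq hζ]
  constructor
  · rintro ⟨-, h⟩
    exact h.symm
  · intro h
    refine ⟨?_, h.symm⟩
    intro h0
    rw [h0, zero_mul] at h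
    exact hζ h.symm

/-! ### The junk graph is an analytic subset of `M × ℙ¹(ℂ)` -/

section JunkGraph

variable {n : ℕ} {X : SchemeOver ℂ}
  {E : Type*} [NormedAddCommGroup E] [NormedSpace ℂ E] [FiniteDimensional ℂ E]
  {M : Type*} [TopologicalSpace M] [ChartedSpace E M] [IsManifold 𝓘(ℂ, E) ω M]
  {φ : M → ComplexPoints X}

omit [IsManifold 𝓘(ℂ, E) ω M] in
/-- **The junk graph is analytic.** For `φ : M → X(ℂ)` an analytification with holomorphic atlas,
`T ⊆ X` open and `g : M → ℂ` locally of the form `g · b(φ ·) = u · a(φ ·)` over `T` with `u`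
holomorphic and nowhere zero, `a, b ∈ Γ(X, W)`, and `T ∩ W = D(a) ∩ D(b)` on complex points, the
junk graph `{(m, ζ) | φ m ∈ T(ℂ) → ζ = [1 : g m]} ⊆ M × ℙ¹(ℂ)` is an analytic subset: on
`φ⁻¹(W(ℂ)) × {ζ_k ≠ 0}` it is the zero set of `(a b)(φ m) · (ζ₁/ζ_k · b(φ m) − ζ₀/ζ_k · u m · a(φ m))`
(over `X ∖ T` the factor `(a b)(φ m)` vanishes and the fibre is all of `ℙ¹`; over `T` it is a unit
and the second factor cuts out the graph). [cite: SerreGAGA1956, n° 20 Remarque 1]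
[cite: Mumford1981, §4B (4.14), p. 67] -/
theorem isAnalyticSet_junkGraph (hφ : IsAnalytification E X n φ) (T : X.left.Opens) (g : M → ℂ)
    (H : ∀ m : M, ∃ (W : X.left.Opens) (a b : Γ(X.left, W)) (u : M → ℂ), (φ m).pt ∈ W ∧
      MDifferentiableOn 𝓘(ℂ, E) 𝓘(ℂ, ℂ) u (φ ⁻¹' {P | P.pt ∈ W}) ∧
      ∀ m', (φ m').pt ∈ W → u m' ≠ 0 ∧
        ((φ m').pt ∈ T ↔ evalOrZero W a (φ m') ≠ 0 ∧ evalOrZero W b (φ m') ≠ 0) ∧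
        ((φ m').pt ∈ T → g m' * evalOrZero W b (φ m') = u m' * evalOrZero W a (φ m'))) :
    IsAnalyticSet (𝓘(ℂ, E).prod 𝓘(ℂ, Fin 1 → ℂ))
      {p : M × ℙ ℂ (Fin 2 → ℂ) | (φ p.1).pt ∈ T →
        p.2 = Projectivization.mk ℂ ![1, g p.1] (by simp)} := by
  classical
  haveI : IsManifold 𝓘(ℂ, Fin 1 → ℂ) ω (ℙ ℂ (Fin 2 → ℂ)) := isManifold_projectivization_holds ℂ 1
  intro p
  obtain ⟨W, a, b, u, hmW, hu, hW⟩ := H p.1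
  obtain ⟨k, hk⟩ := Projectivization.exists_rep_apply_ne_zero p.2
  -- the neighbourhood `φ⁻¹(W(ℂ)) × {ζ_k ≠ 0}`
  set U : Set (M × ℙ ℂ (Fin 2 → ℂ)) :=
    (φ ⁻¹' {P | P.pt ∈ W}) ×ˢ Projectivization.stdChartSource k with hU
  have hUo : IsOpen U := (hφ.isOpen_preimage W).prod (Projectivization.isOpen_stdChartSource k)
  have hpU : p ∈ U := ⟨hmW, hk⟩
  -- holomorphy of the ingredients on `U`
  have hchart : ∀ q ∈ U, MDifferentiableAt (𝓘(ℂ, E).prod 𝓘(ℂ, Fin 1 → ℂ)) 𝓘(ℂ, ℂ)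
      (fun q : M × ℙ ℂ (Fin 2 → ℂ) ↦ Projectivization.stdChart k q.2 0) q := by
    intro q hq
    have hatlas : Projectivization.stdChart k ∈ atlas (Fin 1 → ℂ) (ℙ ℂ (Fin 2 → ℂ)) :=
      Set.mem_range_self k
    have h1 : MDifferentiableAt 𝓘(ℂ, Fin 1 → ℂ) 𝓘(ℂ, Fin 1 → ℂ) (Projectivization.stdChart k) q.2 :=
      mdifferentiableAt_atlas hatlas hq.2
    have h2 : MDifferentiableAt (𝓘(ℂ, E).prod 𝓘(ℂ, Fin 1 → ℂ)) 𝓘(ℂ, Fin 1 → ℂ)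
        (fun q : M × ℙ ℂ (Fin 2 → ℂ) ↦ Projectivization.stdChart k q.2) q :=
      h1.comp q mdifferentiableAt_snd
    exact (ContinuousLinearMap.proj (R := ℂ) (φ := fun _ : Fin 1 ↦ ℂ) 0).hasMFDerivAt.mdifferentiableAt.comp
      q h2
  have hev : ∀ (s : Γ(X.left, W)), ∀ q ∈ U, MDifferentiableAt (𝓘(ℂ, E).prod 𝓘(ℂ, Fin 1 → ℂ)) 𝓘(ℂ, ℂ)
      (fun q : M × ℙ ℂ (Fin 2 → ℂ) ↦ evalOrZero W s (φ q.1)) q := by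
    intro s q hq
    have h1 : MDifferentiableAt 𝓘(ℂ, E) 𝓘(ℂ, ℂ) (fun m ↦ evalOrZero W s (φ m)) q.1 :=
      (IsAnalytification.mdifferentiableOn_evalOrZero_opens_holds hφ W s).mdifferentiableAt
        ((hφ.isOpen_preimage W).mem_nhds hq.1)
    exact h1.comp q mdifferentiableAt_fst
  have huq : ∀ q ∈ U, MDifferentiableAt (𝓘(ℂ, E).prod 𝓘(ℂ, Fin 1 → ℂ)) 𝓘(ℂ, ℂ)
      (fun q : M × ℙ ℂ (Fin 2 → ℂ) ↦ u q.1) q := by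
    intro q hq
    exact (hu.mdifferentiableAt ((hφ.isOpen_preimage W).mem_nhds hq.1)).comp q mdifferentiableAt_fst
  -- the affine coordinate in the chart `k` is `ζ_{k'} / ζ_k`, `k'` the other index
  have hcoord : ∀ q : M × ℙ ℂ (Fin 2 → ℂ),
      Projectivization.stdChart k q.2 0 = q.2.rep (k.succAbove 0) / q.2.rep k := fun q ↦ rfl
  -- the two charts
  obtain rfl | rfl : k = 0 ∨ k = 1 := by fin_cases k <;> simp
  · -- chart `{ζ₀ ≠ 0}`: equation `(a b)(φ m) · (ζ₁/ζ₀ · b(φ m) - u m · a(φ m))`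
    refine ⟨U, hUo, hpU, 1, fun q ↦ fun _ ↦ (evalOrZero W a (φ q.1) * evalOrZero W b (φ q.1)) *
      (Projectivization.stdChart 0 q.2 0 * evalOrZero W b (φ q.1) - u q.1 * evalOrZero W a (φ q.1)),
      ?_, ?_⟩
    · intro q hq
      have h : MDifferentiableAt (𝓘(ℂ, E).prod 𝓘(ℂ, Fin 1 → ℂ)) 𝓘(ℂ, ℂ)
          (fun q : M × ℙ ℂ (Fin 2 → ℂ) ↦ (evalOrZero W a (φ q.1) * evalOrZero W b (φ q.1)) *
            (Projectivization.stdChart 0 q.2 0 * evalOrZero W b (φ q.1) -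
              u q.1 * evalOrZero W a (φ q.1))) q :=
        ((hev a q hq).mul (hev b q hq)).mul (((hchart q hq).mul (hev b q hq)).sub
          ((huq q hq).mul (hev a q hq)))
      exact Literature.Geometry.Kaehler.mdifferentiableWithinAt_pi_space.2 fun _ ↦ h.mdifferentiableWithinAt
    · ext q
      simp only [mem_inter_iff, mem_setOf_eq, mem_preimage]
      constructor
      · rintro ⟨hq, hqU⟩
        refine ⟨hqU, ?_⟩
        have hk0 : q.2.rep 0 ≠ 0 := hqU.2
        funext i
        simp only [Pi.zero_apply]
        by_cases hT : (φ q.1).pt ∈ T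
        · obtain ⟨-, hiff, hrel⟩ := hW q.1 hqU.1
          have hb : evalOrZero W b (φ q.1) ≠ 0 := ((hiff.1 hT)).2
          have hq' := (projectivization_eq_mk_one_iff_of_rep_zero_ne_zero q.2 hk0 (g q.1)).1 (hq hT)
          rw [hcoord, show (0 : Fin 2).succAbove 0 = 1 from rfl, hq']
          have : g q.1 * evalOrZero W b (φ q.1) - u q.1 * evalOrZero W a (φ q.1) = 0 := by
            rw [hrel hT, sub_self]
          rw [this, mul_zero]
        · obtain ⟨-, hiff, -⟩ := hW q.1 hqU.1
          have hab : evalOrZero W a (φ q.1) * evalOrZero W b (φ q.1) = 0 := by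
            by_contra hne
            exact hT (hiff.2 ⟨left_ne_zero_of_mul hne, right_ne_zero_of_mul hne⟩)
          rw [hab, zero_mul]
      · rintro ⟨hqU, hzero⟩
        refine ⟨fun hT ↦ ?_, hqU⟩
        have hk0 : q.2.rep 0 ≠ 0 := hqU.2
        obtain ⟨huz, hiff, hrel⟩ := hW q.1 hqU.1
        obtain ⟨ha, hb⟩ := hiff.1 hT
        have h0 := congrFun hzero 0
        simp only [Pi.zero_apply, mul_eq_zero] at h0
        rcases h0 with (h0 | h0) | h0
        · exact absurd h0 ha
        · exact absurd h0 hb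
        · have hc0 : Projectivization.stdChart 0 q.2 0 = q.2.rep 1 / q.2.rep 0 := hcoord q
          rw [projectivization_eq_mk_one_iff_of_rep_zero_ne_zero q.2 hk0 (g q.1), ← hc0]
          -- `ζ₁/ζ₀ · b = u a = g b`, divide by `b ≠ 0`
          have h1 : Projectivization.stdChart 0 q.2 0 * evalOrZero W b (φ q.1) =
              g q.1 * evalOrZero W b (φ q.1) := by
            rw [hrel hT]
            exact sub_eq_zero.1 h0
          exact mul_right_cancel₀ hb h1
  · -- chart `{ζ₁ ≠ 0}`: equation `(a b)(φ m) · (ζ₀/ζ₁ · u m · a(φ m) - b(φ m))`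
    refine ⟨U, hUo, hpU, 1, fun q ↦ fun _ ↦ (evalOrZero W a (φ q.1) * evalOrZero W b (φ q.1)) *
      (Projectivization.stdChart 1 q.2 0 * u q.1 * evalOrZero W a (φ q.1) - evalOrZero W b (φ q.1)),
      ?_, ?_⟩
    · intro q hq
      have h : MDifferentiableAt (𝓘(ℂ, E).prod 𝓘(ℂ, Fin 1 → ℂ)) 𝓘(ℂ, ℂ)
          (fun q : M × ℙ ℂ (Fin 2 → ℂ) ↦ (evalOrZero W a (φ q.1) * evalOrZero W b (φ q.1)) *
            (Projectivization.stdChart 1 q.2 0 * u q.1 * evalOrZero W a (φ q.1) -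
              evalOrZero W b (φ q.1))) q :=
        ((hev a q hq).mul (hev b q hq)).mul ((((hchart q hq).mul (huq q hq)).mul (hev a q hq)).sub
          (hev b q hq))
      exact Literature.Geometry.Kaehler.mdifferentiableWithinAt_pi_space.2 fun _ ↦ h.mdifferentiableWithinAt
    · ext q
      simp only [mem_inter_iff, mem_setOf_eq, mem_preimage]
      constructor
      · rintro ⟨hq, hqU⟩
        refine ⟨hqU, ?_⟩
        have hk1 : q.2.rep 1 ≠ 0 := hqU.2
        funext i
        simp only [Pi.zero_apply]
        by_cases hT : (φ q.1).pt ∈ T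
        · obtain ⟨-, hiff, hrel⟩ := hW q.1 hqU.1
          have hb : evalOrZero W b (φ q.1) ≠ 0 := ((hiff.1 hT)).2
          have hq' := (projectivization_eq_mk_one_iff_of_rep_one_ne_zero q.2 hk1 (g q.1)).1 (hq hT)
          -- `ζ₀/ζ₁ · g = 1`, so `ζ₀/ζ₁ · u a = ζ₀/ζ₁ · g b = b`
          have : Projectivization.stdChart 1 q.2 0 * u q.1 * evalOrZero W a (φ q.1) -
              evalOrZero W b (φ q.1) = 0 := by
            rw [hcoord, show (1 : Fin 2).succAbove 0 = 0 from rfl, mul_assoc, ← hrel hT, ← mul_assoc,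
              hq', one_mul, sub_self]
          rw [this, mul_zero]
        · obtain ⟨-, hiff, -⟩ := hW q.1 hqU.1
          have hab : evalOrZero W a (φ q.1) * evalOrZero W b (φ q.1) = 0 := by
            by_contra hne
            exact hT (hiff.2 ⟨left_ne_zero_of_mul hne, right_ne_zero_of_mul hne⟩)
          rw [hab, zero_mul]
      · rintro ⟨hqU, hzero⟩
        refine ⟨fun hT ↦ ?_, hqU⟩
        have hk1 : q.2.rep 1 ≠ 0 := hqU.2
        obtain ⟨huz, hiff, hrel⟩ := hW q.1 hqU.1
        obtain ⟨ha, hb⟩ := hiff.1 hT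
        have h0 := congrFun hzero 0
        simp only [Pi.zero_apply, mul_eq_zero] at h0
        rcases h0 with (h0 | h0) | h0
        · exact absurd h0 ha
        · exact absurd h0 hb
        · rw [projectivization_eq_mk_one_iff_of_rep_one_ne_zero q.2 hk1 (g q.1)]
          have h1 : Projectivization.stdChart 1 q.2 0 * u q.1 * evalOrZero W a (φ q.1) =
              evalOrZero W b (φ q.1) := sub_eq_zero.1 h0
          rw [mul_assoc, ← hrel hT, ← mul_assoc] at h1
          -- `(ζ₀/ζ₁ · g) · b = b`, cancel `b ≠ 0`
          have h2 : Projectivization.stdChart 1 q.2 0 * g q.1 = 1 := by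
            have := mul_right_cancel₀ hb (h1.trans (one_mul _).symm)
            exact this
          rwa [hcoord, show (1 : Fin 2).succAbove 0 = 0 from rfl] at h2

/-- **Chow's theorem on the junk graph.** For `X` smooth projective over `ℂ` with analytification
`φ : M → X(ℂ)`, `T ⊆ X` open and `g : M → ℂ` locally `(holomorphic unit) · (a/b)^an` over `T` with
`T ∩ W = D(a) ∩ D(b)` (hypothesis `H` as in `isAnalyticSet_junkGraph`), there is a Zariski-CLOSED
`Z ⊆ X ×_ℂ ℙ¹` whose complex points over `x ∈ X(ℂ)` are: all of `ℙ¹(ℂ)` if `x ∉ T`, and the single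
point `[1 : g(φ⁻¹ x)]` if `x ∈ T`. Proof: the junk graph is an analytic subset of `M × ℙ¹(ℂ)`
(`isAnalyticSet_junkGraph`); pull it back to an analytification `N` of the smooth projective
`X ×_ℂ ℙ¹` (`IsSmoothProjective.tensor_holds`, `exists_isAnalytification_holds`) along the holomorphic
map `N → M × ℙ¹(ℂ)` given by the two projections (`IsAnalytification.mdifferentiable_comp_map_holds`)
and apply Chow's theorem (`chow_analyticSet_analytification_holds`) — verbatim the route of the tree's
GAGA for maps (`arapura2012_cor_15_4_6_holds`). [cite: SerreGAGA1956, n° 19 Prop. 13 and n° 20 Remarque 1]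
[cite: Mumford1981, §4B (4.14), p. 67] -/
theorem exists_isClosed_junkGraph (hX : IsSmoothProjective n X) (hφ : IsAnalytification E X n φ)
    (T : X.left.Opens) (g : M → ℂ)
    (H : ∀ m : M, ∃ (W : X.left.Opens) (a b : Γ(X.left, W)) (u : M → ℂ), (φ m).pt ∈ W ∧
      MDifferentiableOn 𝓘(ℂ, E) 𝓘(ℂ, ℂ) u (φ ⁻¹' {P | P.pt ∈ W}) ∧
      ∀ m', (φ m').pt ∈ W → u m' ≠ 0 ∧
        ((φ m').pt ∈ T ↔ evalOrZero W a (φ m') ≠ 0 ∧ evalOrZero W b (φ m') ≠ 0) ∧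
        ((φ m').pt ∈ T → g m' * evalOrZero W b (φ m') = u m' * evalOrZero W a (φ m'))) :
    ∃ Z : Set ↥(X ⊗ projectiveSpace 1 ℂ).left, IsClosed Z ∧
      ∀ (x : ComplexPoints X) (y : ComplexPoints (projectiveSpace 1 ℂ)),
        AlgPoints.pt (CartesianMonoidalCategory.lift x y : ComplexPoints (X ⊗ projectiveSpace 1 ℂ)) ∈ Z ↔
          (x.pt ∈ T → y = projPoint 1 (Projectivization.mk ℂ ![1, g (hφ.homeomorph.symm x)] (by simp))) := by
  classical
  haveI : IsManifold 𝓘(ℂ, Fin 1 → ℂ) ω (ℙ ℂ (Fin 2 → ℂ)) := isManifold_projectivization_holds ℂ 1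
  have hY : IsSmoothProjective 1 (projectiveSpace 1 ℂ) :=
    Literature.AlgebraicGeometry.Motives.isSmoothProjective_projectiveSpace_holds ℂ 1
  have hψ : IsAnalytification (Fin 1 → ℂ) (projectiveSpace 1 ℂ) 1 (projPoint 1) :=
    isAnalytification_projPoint 1
  -- instances carried by the smooth projective `X`, `ℙ¹`, `X ×_ℂ ℙ¹`
  haveI : SmoothOfRelativeDimension n X.hom := hX.smoothOfRelativeDimension
  haveI : Smooth X.hom := SmoothOfRelativeDimension.smooth n X.hom
  haveI : LocallyOfFiniteType X.hom := inferInstance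
  haveI : SmoothOfRelativeDimension 1 (projectiveSpace 1 ℂ).hom := hY.smoothOfRelativeDimension
  haveI : Smooth (projectiveSpace 1 ℂ).hom := SmoothOfRelativeDimension.smooth 1 (projectiveSpace 1 ℂ).hom
  haveI : LocallyOfFiniteType (projectiveSpace 1 ℂ).hom := inferInstance
  have hXY : IsSmoothProjective (n + 1) (X ⊗ projectiveSpace 1 ℂ) := IsSmoothProjective.tensor_holds hX hY
  haveI : SmoothOfRelativeDimension (n + 1) (X ⊗ projectiveSpace 1 ℂ).hom := hXY.smoothOfRelativeDimension
  haveI : Smooth (X ⊗ projectiveSpace 1 ℂ).hom :=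
    SmoothOfRelativeDimension.smooth (n + 1) (X ⊗ projectiveSpace 1 ℂ).hom
  haveI : LocallyOfFiniteType (X ⊗ projectiveSpace 1 ℂ).hom := inferInstance
  haveI : IsProper (X ⊗ projectiveSpace 1 ℂ).hom := IsSmoothProjective.isProper_holds hXY
  haveI : IsSeparated (X ⊗ projectiveSpace 1 ℂ).hom := inferInstance
  -- an analytification `χ : N → (X ×_ℂ ℙ¹)(ℂ)` of the product
  obtain ⟨N, _, _, _, _, χ, hχ⟩ := exists_isAnalytification_holds (X ⊗ projectiveSpace 1 ℂ) (n + 1)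
  -- the two projections `N → M`, `N → ℙ¹(ℂ)` are holomorphic
  obtain ⟨π₁, hπ₁⟩ : ∃ π₁ : N → M, π₁ = fun z ↦
      hφ.homeomorph.symm (AlgPoints.map (CartesianMonoidalCategory.fst X (projectiveSpace 1 ℂ)) (χ z)) :=
    ⟨_, rfl⟩
  obtain ⟨π₂, hπ₂⟩ : ∃ π₂ : N → ℙ ℂ (Fin 2 → ℂ), π₂ = fun z ↦
      hψ.homeomorph.symm (AlgPoints.map (CartesianMonoidalCategory.snd X (projectiveSpace 1 ℂ)) (χ z)) :=
    ⟨_, rfl⟩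
  have hπ₁φ : ∀ z, φ (π₁ z) = AlgPoints.map (CartesianMonoidalCategory.fst X (projectiveSpace 1 ℂ)) (χ z) :=
    fun z ↦ by
    rw [hπ₁]
    exact hφ.homeomorph.apply_symm_apply _
  have hπ₂ψ : ∀ z, projPoint 1 (π₂ z) =
      AlgPoints.map (CartesianMonoidalCategory.snd X (projectiveSpace 1 ℂ)) (χ z) := fun z ↦ by
    rw [hπ₂]
    exact hψ.homeomorph.apply_symm_apply _
  have hπ₁d : MDifferentiable 𝓘(ℂ, Fin (n + 1) → ℂ) 𝓘(ℂ, E) π₁ :=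
    IsAnalytification.mdifferentiable_comp_map_holds hχ hφ
      (CartesianMonoidalCategory.fst X (projectiveSpace 1 ℂ)) π₁ (funext hπ₁φ)
  have hπ₂d : MDifferentiable 𝓘(ℂ, Fin (n + 1) → ℂ) 𝓘(ℂ, Fin 1 → ℂ) π₂ :=
    IsAnalytification.mdifferentiable_comp_map_holds hχ hψ
      (CartesianMonoidalCategory.snd X (projectiveSpace 1 ℂ)) π₂ (funext hπ₂ψ)
  have hΘ : MDifferentiable 𝓘(ℂ, Fin (n + 1) → ℂ) (𝓘(ℂ, E).prod 𝓘(ℂ, Fin 1 → ℂ))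
      (fun z ↦ (π₁ z, π₂ z)) := hπ₁d.prodMk hπ₂d
  -- the junk graph, an analytic subset of `M × ℙ¹(ℂ)`, pulled back to `N`
  have hS := isAnalyticSet_junkGraph hφ T g H
  have hS' : IsAnalyticSet 𝓘(ℂ, Fin (n + 1) → ℂ)
      ((fun z ↦ (π₁ z, π₂ z)) ⁻¹' {p : M × ℙ ℂ (Fin 2 → ℂ) | (φ p.1).pt ∈ T →
        p.2 = Projectivization.mk ℂ ![1, g p.1] (by simp)}) := hS.preimage hΘ
  -- Chow's theorem on `X ×_ℂ ℙ¹`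
  obtain ⟨Z, hZc, hZ⟩ := chow_analyticSet_analytification_holds hXY hχ _ hS'
  refine ⟨Z, hZc, fun x y ↦ ?_⟩
  obtain ⟨z, hz⟩ : ∃ z : N, z = hχ.homeomorph.symm (CartesianMonoidalCategory.lift x y) := ⟨_, rfl⟩
  have hχz : χ z = CartesianMonoidalCategory.lift x y := by
    rw [hz]
    exact hχ.homeomorph.apply_symm_apply _
  have h1 : AlgPoints.pt (CartesianMonoidalCategory.lift x y : ComplexPoints (X ⊗ projectiveSpace 1 ℂ)) ∈ Z ↔
      z ∈ χ ⁻¹' {P | P.pt ∈ Z} := by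
    rw [mem_preimage, mem_setOf_eq, hχz]
  have hπ₁z : π₁ z = hφ.homeomorph.symm x := by
    rw [hπ₁]
    simp only [hχz, AlgPoints.map_apply, CartesianMonoidalCategory.lift_fst]
  have hπ₂z : π₂ z = hψ.homeomorph.symm y := by
    rw [hπ₂]
    simp only [hχz, AlgPoints.map_apply, CartesianMonoidalCategory.lift_snd]
  have hφx : φ (hφ.homeomorph.symm x) = x := hφ.homeomorph.apply_symm_apply x
  rw [h1, ← hZ, mem_preimage, mem_setOf_eq, hπ₁z, hπ₂z, hφx]
  refine imp_congr Iff.rfl ?_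
  constructor
  · intro h
    have h' := congrArg hψ.homeomorph h
    rw [Homeomorph.apply_symm_apply] at h'
    exact h'
  · intro h
    apply hψ.homeomorph.injective
    rw [Homeomorph.apply_symm_apply]
    exact h

end JunkGraph

end Literature.AlgebraicGeometry.HodgeTheory
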